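import Mathlib
import Literature.Computability.Complexity.CircuitDAG
import Summits.PneNP.PneNP.Theorems.SymmetryBudgetHamCompilesFDagSem

/-!
# Structural gate equations of the F-side DAG (stub `stub_symmetricF`, obligation 3/5, line
# `kotzig-cutspan`, crux `SymmetryBudget.HamCompiles`, stmt-PneNP-10637)

`stub_symmetricF_struct : WireVals m x → StructEqs m x`: granted the wire values
(`SymmetryBudgetHamCompilesFDagSem.lean`, §6), every gate label of the F-side DAG other than the
block gates satisfies its gate equation `fsem l = (ffn l).2 (wsem ∘ fargs l)`:

* the embedded rank gadget (`SymA.rsem_eq`),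
* the constants `zero` / `one` and the hard-wired table `unitC` of `C(∅, e)`,
* the tower bases `ob` (`AND₂` of `[rk t = i]` and the table of `C(P∖t, e)`),
* the tower `∨`-nodes `tw` — all `|B|` disjuncts are equal, by the lattice identity
  `TS τ (B∖w) ⊔ term w = TS τ B` for `w ∈ B` (`TS_erase_sup`),
* the guarded row sources `rowO` (`AND₂` of the edge gate and the table of `O(P∖t, w, i, e)`;
  the corner `w = t` is the empty open state `Ospan_eq`) and `rowI`.
-/

-- `Summit.PneNP.PneNP.…` duplicates `PneNP` BY DESIGN (single-problem summit, D-0017).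
set_option linter.dupNamespace false

noncomputable section

namespace Summit.PneNP.PneNP.Theorems.HamCompilesKC

open Literature.Computability.Complexity
open Finset

namespace SymF

namespace Struct

variable {m : ℕ} (x : Fin m × Fin m → Bool)

/-! ### Small evaluations -/

/-- `tb 0 = false`. -/
theorem tb_zero : tb (0 : ZMod 2) = false := by decide

/-- The bottom subspace has no pivots, so its table vanishes. -/
theorem rrefRow_bot {g : ℕ} (c : Fin g → Bool) :
    rrefRow (⊥ : Submodule (ZMod 2) (Vec g)) c = 0 := by
  funext c'
  unfold rrefRow
  rw [if_neg]
  · rfl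
  · rintro ⟨w, hw, hwc, -, -, -⟩
    rw [Submodule.mem_bot] at hw
    subst hw
    exact zero_ne_one hwc

/-- A table bit of the bottom subspace is `false`. -/
theorem tb_rrefRow_bot {g : ℕ} (c c' : Fin g → Bool) :
    tb (rrefRow (⊥ : Submodule (ZMod 2) (Vec g)) c c') = false := by
  rw [rrefRow_bot]; exact tb_zero

/-- The binary conjunction gate. -/
theorem and2_apply (v : Fin 2 → Bool) : (GateFn.and 2).2 v = (v 0 && v 1) := by
  simp [GateFn.and, Fin.forall_fin_two]

/-- Value of the zero wire. -/
theorem wsem_zeroW : wsem m x zeroW = false := rfl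

/-- Value of the rank test wire `[rk t = i]`. -/
theorem wsem_eqrankW (i : Fin (gOf m)) (t : Fin m) :
    wsem m x (eqrankW i t) = decide (rk m x t = (i : ℕ)) := rfl

/-- Value of the edge wire `x(w,t) ∨ x(t,w)`. -/
theorem wsem_adjW (w t : Fin m) : wsem m x (adjW w t) = (x (w, t) || x (t, w)) := rfl

/-- Value of the output table of a chain (the `out` gates of the last block). -/
theorem wsem_chOut (χ : ChCtx m) (c c' : K m) :
    wsem m x (chOut χ c c') = tb (rrefRow (CH m x χ ((kLast m : ℕ) + 1)) c c') := rfl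

/-- The last block is followed by `N`. -/
theorem kLast_succ (m : ℕ) : (kLast m : ℕ) + 1 = N m :=
  Nat.sub_add_cancel (N_pos m)

/-! ### The lattice identity of the tower -/

/-- **All copies of a tower node agree**: `TS τ (B∖w) ⊔ term w = TS τ B` for `w ∈ B`. -/
theorem TS_erase_sup (τ : TCtx m) {B : PSet m} {w : Fin m} (hw : w ∈ B.1) :
    TS m x τ (B.erase w) ⊔ termSub m x τ w = TS m x τ B := by
  unfold TS
  rw [sup_assoc]
  congr 1
  show (⨆ u ∈ B.1.erase w, termSub m x τ u) ⊔ termSub m x τ w = ⨆ u ∈ B.1, termSub m x τ u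
  conv_rhs => rw [← Finset.insert_erase hw]
  rw [Finset.iSup_insert, sup_comm]

/-! ### The gate equations, case by case -/

/-- The embedded rank gadget. -/
theorem eq_inl (l : SymA.RΛ m) :
    fsem m x (Sum.inl l) = (ffn m (Sum.inl l)).2 fun a => wsem m x (fargs (Sum.inl l) a) := by
  show SymA.rsem m x l = (SymA.rfn l).2 fun a => wsem m x ((SymA.rargs l a).map id Sum.inl)
  refine (SymA.rsem_eq x l).trans (congrArg (SymA.rfn l).2 (funext fun a => ?_))
  cases SymA.rargs l a <;> rfl

/-- The constant `false`. -/
theorem eq_zero : fsem m x (Sum.inr .zero) =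
    (ffn m (Sum.inr .zero)).2 fun a => wsem m x (fargs (Sum.inr .zero) a) := by
  show false = (GateFn.or 0).2 _
  simp [GateFn.or]

/-- The constant `true`. -/
theorem eq_one : fsem m x (Sum.inr .one) =
    (ffn m (Sum.inr .one)).2 fun a => wsem m x (fargs (Sum.inr .one) a) := by
  show true = (GateFn.and 0).2 _
  simp [GateFn.and]

/-- The hard-wired table of `C(∅, e)`. -/
theorem eq_unitC (e : Cd m) (c c' : K m) :
    fsem m x (Sum.inr (.unitC e c c')) =
      (ffn m (Sum.inr (.unitC e c c'))).2
        fun a => wsem m x (fargs (Sum.inr (.unitC e c c')) a) :=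
  rfl

/-- The base of an open tower: `[rk t = i] ∧ C(P∖t, e)[c][c']`. -/
theorem eq_ob (hW : WireVals m x) (P : PSet m) (t : Fin m) (i : Fin (gOf m)) (e : Cd m)
    (c c' : K m) :
    fsem m x (Sum.inr (.ob P t i e c c')) = (ffn m (Sum.inr (.ob P t i e c c'))).2
      fun a => wsem m x (fargs (Sum.inr (.ob P t i e c c')) a) := by
  show tb (rrefRow (baseSub m x (.ot P t i e)) c c') = (GateFn.and 2).2 fun a =>
    wsem m x (![eqrankW i t, if t ∈ P.1 then cTab (P.erase t) e c c' else zeroW] a)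
  rw [and2_apply]
  simp only [Matrix.cons_val_zero, Matrix.cons_val_one, wsem_eqrankW, baseSub,
    gsub]
  by_cases ht : t ∈ P.1
  · rw [if_pos ht, hW.2.1]
    by_cases hr : rk m x t = (i : ℕ)
    · rw [if_pos ⟨hr, ht⟩]; simp [hr]
    · rw [if_neg fun h => hr h.1, tb_rrefRow_bot]; simp [hr]
  · rw [if_neg fun h => ht h.2, if_neg ht, tb_rrefRow_bot, wsem_zeroW, Bool.and_false]

/-- A tower `∨`-node: every disjunct `w ∈ B` carries the table of `TS τ B`, the others are `0`. -/
theorem eq_tw (hW : WireVals m x) (τ : TCtx m) (B : PSet m) (c c' : K m) :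
    fsem m x (Sum.inr (.tw τ B c c')) =
      (ffn m (Sum.inr (.tw τ B c c'))).2
        fun a => wsem m x (fargs (Sum.inr (.tw τ B c c')) a) := by
  have key : ∀ w : Fin m, wsem m x (if w ∈ B.1 then chOut (.tw τ B w) c c' else zeroW) =
      (decide (w ∈ B.1) && tb (rrefRow (TS m x τ B) c c')) := by
    intro w
    by_cases hw : w ∈ B.1
    · rw [if_pos hw, wsem_chOut, kLast_succ, hW.2.2.2.2.2.2.2.2 (.tw τ B w)]
      simp only [leftSub, chainTerm, hw, ite_true, TS_erase_sup x τ hw, decide_true,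
        Bool.true_and]
    · rw [if_neg hw, wsem_zeroW]; simp [hw]
  show (if B.1 = ∅ then false else tb (rrefRow (TS m x τ B) c c')) =
    decide (∃ w : Fin m, wsem m x (if w ∈ B.1 then chOut (.tw τ B w) c c' else zeroW) = true)
  simp only [key, Bool.and_eq_true, decide_eq_true_eq]
  by_cases hB : B.1 = ∅
  · rw [if_pos hB]; simp [hB]
  · rw [if_neg hB]
    obtain ⟨w, hw⟩ := Finset.nonempty_iff_ne_empty.2 hB
    rw [eq_comm, Bool.eq_iff_iff, decide_eq_true_eq]
    exact ⟨fun ⟨_, _, h⟩ => h, fun h => ⟨w, hw, h⟩⟩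

/-- The open state at its own erased set is empty: `O(P∖t, t, i, e) = ⊥`. -/
theorem OS_erase_self (P : PSet m) (t : Fin m) (i : Fin (gOf m)) (e : Cd m) :
    OS m x (P.erase t) t i e = ⊥ := by
  unfold OS
  rw [Ospan_eq, if_neg]
  exact Finset.notMem_erase t P.1

/-- The guarded row source of an open tower: `[w ∼ t] ∧ O(P∖t, w, i, e)[kc k][c']`. -/
theorem eq_rowO (hW : WireVals m x) (P : PSet m) (t : Fin m) (i : Fin (gOf m)) (e : Cd m)
    (w : Fin m) (k : Fin (N m)) (c' : K m) :
    fsem m x (Sum.inr (.rowO P t i e w k c')) = (ffn m (Sum.inr (.rowO P t i e w k c'))).2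
      fun a => wsem m x (fargs (Sum.inr (.rowO P t i e w k c')) a) := by
  show (decide ((Gr m x).Adj w t ∧ t ∈ P.1) &&
      tb (rrefRow (OS m x (P.erase t) w i e) (kc k) c')) = (GateFn.and 2).2 fun a =>
      wsem m x (![adjW w t, if t ∈ P.1 then oTab (P.erase t) w i e (kc k) c' else zeroW] a)
  rw [and2_apply]
  simp only [Matrix.cons_val_zero, Matrix.cons_val_one, wsem_adjW]
  by_cases ht : t ∈ P.1
  · rw [if_pos ht, hW.1]
    by_cases hwt : w = t
    · subst hwt
      rw [OS_erase_self, tb_rrefRow_bot, Bool.and_false, Bool.and_false]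
    · have hadj : (Gr m x).Adj w t ↔ (x (w, t) = true ∨ x (t, w) = true) := by
        rw [SymA.gr_adj_iff]; exact ⟨fun h => h.2, fun h => ⟨hwt, h⟩⟩
      have : decide ((Gr m x).Adj w t ∧ t ∈ P.1) = (x (w, t) || x (t, w)) := by
        rw [Bool.eq_iff_iff]
        simp only [decide_eq_true_eq, Bool.or_eq_true, hadj, ht, and_true]
      rw [this]
  · rw [if_neg ht, wsem_zeroW, Bool.and_false]
    simp [ht]

/-- The guarded row source of an inner accumulation:
`[rk t = j] ∧ O(P, t, i, e−δᵢ−δⱼ)[kc k][c']`. -/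
theorem eq_rowI (hW : WireVals m x) (P : PSet m) (e : Cd m) (t : Fin m)
    (r : Fin (gOf m * gOf m)) (k : Fin (N m)) (c' : K m) :
    fsem m x (Sum.inr (.rowI P e t r k c')) = (ffn m (Sum.inr (.rowI P e t r k c'))).2
      fun a => wsem m x (fargs (Sum.inr (.rowI P e t r k c')) a) := by
  show (decide (rk m x t = ((pr r).2 : ℕ)) &&
      tb (rrefRow (OS m x P t (pr r).1 (cminus e (pr r).1 (pr r).2)) (kc k) c')) =
    (GateFn.and 2).2 fun a => wsem m x
      (![eqrankW (pr r).2 t, oTab P t (pr r).1 (cminus e (pr r).1 (pr r).2) (kc k) c'] a)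
  rw [and2_apply]
  simp only [Matrix.cons_val_zero, Matrix.cons_val_one, wsem_eqrankW, hW.1]

end Struct

end SymF

/-- **Structural gate equations of the F-side DAG** (obligation 3/5 of `stub_symmetricF`, line
`kotzig-cutspan`): granted the wire values, the gadget gates, the constants, the hard-wired
`C(∅, e)`, the tower bases, the tower `∨`-nodes and the guarded row sources all satisfy their gate
equations. -/
theorem stub_symmetricF_struct (m : ℕ) (x : Fin m × Fin m → Bool) :
    SymF.WireVals m x → SymF.StructEqs m x := by
  intro hW l
  rcases l with l | f
  · exact SymF.Struct.eq_inl x l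
  · cases f with
    | zero => exact SymF.Struct.eq_zero x
    | one => exact SymF.Struct.eq_one x
    | unitC e c c' => exact SymF.Struct.eq_unitC x e c c'
    | ob P t i e c c' => exact SymF.Struct.eq_ob x hW P t i e c c'
    | tw τ B c c' => exact SymF.Struct.eq_tw x hW τ B c c'
    | rowO P t i e w k c' => exact SymF.Struct.eq_rowO x hW P t i e w k c'
    | rowI P e t r k c' => exact SymF.Struct.eq_rowI x hW P e t r k c'
    | blk χ k κ => trivial

end Summit.PneNP.PneNP.Theorems.HamCompilesKC
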